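import Summits.QuantumFields.YangMills.Theorems.UnitScaleTiltProp7RTermFloor
import HarnessLib

/-!
# Route `UnitScaleTilt`, crux K1 «MinimiserStabilityRegPr» (stmt-QuantumFields-19200), EX row `hGF[Lift]` (curved member) — **LOD LINE, PEN (L5″) FILE 2a (ABSTRACT, ROAD (α)):
# THE PROJECTOR TELESCOPE EVALUATED ON VECTORS** — `⟨g,(P − P′)f⟩ = ⟨(B† − B′†)g, N(B†f)⟩ + ⟨B′†g,(N − N′)(B†f)⟩ + ⟨B′†g, N′((B† − B′†)f)⟩` for `P = B N B†`,
# so that THREE LOCAL ROWS (smallness of `B† − B′†` and of `N − N′` on the vectors actually in play) replace the three GLOBAL operator norms of FILE 1 (✓p750181).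

Cell `ym3-torus` (HUMAN RULING D-0037, YM ladder rung R3 — NOT d = 4, NOT infinite volume, NOT a mass gap, NOT Clay).  Width seat `ym-routeR-w3` gen 12; ★p1 g24
LOCATE-L6-ASSEMBLY §1 Step I.2 (L5″), road (α) adopted 2026-08-29 23:17:20Z; this seat's LOCATE-L5pp-FILE2 (bce81fab) §0∕§2∕§3.  THEOREMS ONLY (0 `def`, 0 `sorry`), Mathlib +
✓`Prop7RTermFloor` (`complex_re_inner_self`, `complex_re_le_norm`); `--supports stmt-QuantumFields-19200 --as helper`, count-neutral.  HONEST LABEL (★★OWNER RULING №33 (6)):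
curved γ-row supplier line (LOD localisation), pen (L5″); ABSTRACT inner-product-space algebra — nothing of (3.49), Thm 3.1∕3.3, `h349`, `hGF`, EX ∕ 19200 is proved here.

WHY (road (α)).  The two systems compared in Step I.2 are GLOBAL: `(G_U, Q″_U)` and `(G_V, Q″_V)` with `V` the pure gauge of a global extension of the axial gauge of the cube
`□̃_j`; they agree (to `O(R″ε₀)`) only ON `□̃_j`, so `‖B_U − B_V‖`, `‖M_U − M_V‖` are `O(1)` and FILE 1's operator-norm telescope cannot be fed.  What is small is every factor
APPLIED TO A VECTOR LOCALISED AT `□_j` (near `□̃_j`: the form rows (M1)–(M3) + ✓`Prop7CutoffResolventComparison`; far: exponential decay of `G f`, `M⁻¹`).  This file is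
the vector-level bookkeeping: the identity (§1), the bilinear bound with the three local deltas as hypotheses ON THE VECTORS `f, g` (§2), and the squares∕relative-currency
step that turns `⟨f,(P_U − P_V)f⟩` plus `‖f_U − f_V‖ ≤ κ‖A‖` into the chair's Step I.2 shape `θ‖f_U‖² + C‖A‖²` (§3).  `B†` is written `Bad` (an adjoint is a HYPOTHESIS
`⟪B c, x⟫ = ⟪c, Bad x⟫`, as in ✓`Prop7RTermFloor`); at the member `B = G∘T`, `B† = Q″∘G`, `N = M⁻¹`.

WHAT IS PROVED (ns `Summit.QuantumFields.YangMills.Theorems.Prop7ProjectorPerturbationLocal`; `E` fine, `C` coarse complex inner-product spaces).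
* §1 `inner_sandwich_eq` (`⟪g, B(N(B†f))⟫ = ⟪B†g, N(B†f)⟫`), ★★ `inner_proj_sub_proj_eq` (THE TELESCOPE ON VECTORS).
* §2 ★★★ `norm_inner_proj_sub_proj_le` — with `‖Nw‖ ≤ ν‖w‖`, `‖N′w‖ ≤ ν′‖w‖`, `‖B†x‖ ≤ b‖x‖`, `‖B′†x‖ ≤ b′‖x‖` (global, harmless) and the LOCAL rows
  `‖(B† − B′†)f‖ ≤ δ₁‖f‖`, `‖(B† − B′†)g‖ ≤ δ₁‖g‖`, `‖(N − N′)(B†f)‖ ≤ δ₂‖f‖`: **`‖⟪g,(P − P′)f⟫‖ ≤ (δ₁νb + b′δ₂ + b′ν′δ₁)·‖g‖·‖f‖`**.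
* §3 `re_inner_sub_re_inner_le` (`|Re⟪f,Tf⟫ − Re⟪f′,Tf′⟫| ≤ ‖f − f′‖(‖f‖ + ‖f′‖)` for a contraction `T`), ★★ `abs_re_inner_sub_le_of_local`
  (`|Re⟪f,Pf⟫ − Re⟪f′,P′f′⟫| ≤ δ_P‖f‖² + ‖f − f′‖(‖f‖ + ‖f′‖)`), ★★★ `abs_re_inner_sub_le_relative` (with `‖f − f′‖ ≤ κa`, any `θ > 0`:
  `≤ (δ_P + θ)‖f‖² + (1 + θ⁻¹)κ²a²` — the RELATIVE currency of the chair's 23:14:03Z note), `complex_re_inner_starProjection_self` (`Re⟪f, Pf⟫ = ‖Pf‖²` for an orthogonal projection,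
  so §3 reads on `‖P_U(D*_UA_j)‖² − ‖P_V(D*_VA_j)‖²`; `‖P′x‖ ≤ ‖x‖` is Mathlib's `Submodule.norm_starProjection_apply_le`).

References: T. Bałaban, CMP **99** (1985) 389–434 [Balaban1985BackgroundPropagators] ((3.20)–(3.23) p.394, (3.49) p.399, (3.105) p.414); T. Kato, *Perturbation theory for
linear operators* (1966) I §4.4 [folklore].
-/

set_option autoImplicit false

noncomputable section

open scoped InnerProductSpace ComplexConjugate

namespace Summit.QuantumFields.YangMills.Theorems.Prop7ProjectorPerturbationLocal

open Summit.QuantumFields.YangMills.Theorems.Prop7RTermFloor (complex_re_inner_self complex_re_le_norm)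

variable {E C : Type*} [NormedAddCommGroup E] [InnerProductSpace ℂ E] [NormedAddCommGroup C] [InnerProductSpace ℂ C]

/-! ## §1 The telescope on vectors -/

/-- `⟪g, B(N(B†f))⟫ = ⟪B†g, N(B†f)⟫` for an adjoint pair `(B, B†)`. [cite: Balaban1985BackgroundPropagators, (3.21) p.394] -/
theorem inner_sandwich_eq (B : C →ₗ[ℂ] E) (Bad : E →ₗ[ℂ] C) (hB : ∀ (c : C) (x : E), ⟪B c, x⟫_ℂ = ⟪c, Bad x⟫_ℂ) (N : C →ₗ[ℂ] C) (f g : E) :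
    ⟪g, B (N (Bad f))⟫_ℂ = ⟪Bad g, N (Bad f)⟫_ℂ := by
  rw [← inner_conj_symm, hB, inner_conj_symm]

/-- ★★ **THE TELESCOPE ON VECTORS**: for `P = B N B†`, `P′ = B′N′B′†` (adjoint pairs `(B,B†)`, `(B′,B′†)`) and any `f, g`:
`⟪g,(P − P′)f⟫ = ⟪(B† − B′†)g, N(B†f)⟫ + ⟪B′†g, (N − N′)(B†f)⟫ + ⟪B′†g, N′((B† − B′†)f)⟫`. [cite: Balaban1985BackgroundPropagators, (3.20)–(3.23) p.394, (3.105) p.414] -/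
theorem inner_proj_sub_proj_eq (B B' : C →ₗ[ℂ] E) (Bad Bad' : E →ₗ[ℂ] C) (hB : ∀ (c : C) (x : E), ⟪B c, x⟫_ℂ = ⟪c, Bad x⟫_ℂ)
    (hB' : ∀ (c : C) (x : E), ⟪B' c, x⟫_ℂ = ⟪c, Bad' x⟫_ℂ) (N N' : C →ₗ[ℂ] C) (f g : E) :
    ⟪g, B (N (Bad f)) - B' (N' (Bad' f))⟫_ℂ
      = ⟪(Bad - Bad') g, N (Bad f)⟫_ℂ + ⟪Bad' g, (N - N') (Bad f)⟫_ℂ + ⟪Bad' g, N' ((Bad - Bad') f)⟫_ℂ := by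
  rw [inner_sub_right, inner_sandwich_eq B Bad hB, inner_sandwich_eq B' Bad' hB', LinearMap.sub_apply, LinearMap.sub_apply, LinearMap.sub_apply,
    inner_sub_left, map_sub, inner_sub_right, inner_sub_right]
  ring

/-! ## §2 The bilinear bound with LOCAL deltas -/

/-- ★★★ **THE BILINEAR BOUND WITH THREE LOCAL ROWS**: global bounds `‖Nw‖ ≤ ν‖w‖`, `‖N′w‖ ≤ ν′‖w‖`, `‖B†x‖ ≤ b‖x‖`, `‖B′†x‖ ≤ b′‖x‖` (`m₀⁻¹`, `‖Q″‖m⁻¹` at the member)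
and, ON THE VECTORS `f, g` ONLY, `‖(B† − B′†)f‖ ≤ δ₁‖f‖`, `‖(B† − B′†)g‖ ≤ δ₁‖g‖` ((R-B) of LOCATE-L5pp-FILE2) and `‖(N − N′)(B†f)‖ ≤ δ₂‖f‖` ((R-N)) give
**`‖⟪g,(P − P′)f⟫‖ ≤ (δ₁·ν·b + b′·δ₂ + b′·ν′·δ₁)·‖g‖·‖f‖`** — the vector edition of ✓`Prop7ProjectorPerturbation.norm_proj_sub_proj_le`.
[cite: Balaban1985BackgroundPropagators, (3.20)–(3.23) p.394, (3.49) p.399] -/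
theorem norm_inner_proj_sub_proj_le (B B' : C →ₗ[ℂ] E) (Bad Bad' : E →ₗ[ℂ] C) (hB : ∀ (c : C) (x : E), ⟪B c, x⟫_ℂ = ⟪c, Bad x⟫_ℂ)
    (hB' : ∀ (c : C) (x : E), ⟪B' c, x⟫_ℂ = ⟪c, Bad' x⟫_ℂ) (N N' : C →ₗ[ℂ] C) {ν ν' b b' δ₁ δ₂ : ℝ} (hν : 0 ≤ ν) (hν' : 0 ≤ ν') (hb' : 0 ≤ b') (hδ₁ : 0 ≤ δ₁)
    (hN : ∀ w, ‖N w‖ ≤ ν * ‖w‖) (hN' : ∀ w, ‖N' w‖ ≤ ν' * ‖w‖) (hBad : ∀ x, ‖Bad x‖ ≤ b * ‖x‖) (hBad' : ∀ x, ‖Bad' x‖ ≤ b' * ‖x‖)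
    (f g : E) (h1f : ‖(Bad - Bad') f‖ ≤ δ₁ * ‖f‖) (h1g : ‖(Bad - Bad') g‖ ≤ δ₁ * ‖g‖) (h2 : ‖(N - N') (Bad f)‖ ≤ δ₂ * ‖f‖) :
    ‖⟪g, B (N (Bad f)) - B' (N' (Bad' f))⟫_ℂ‖ ≤ (δ₁ * ν * b + b' * δ₂ + b' * ν' * δ₁) * ‖g‖ * ‖f‖ := by
  rw [inner_proj_sub_proj_eq B B' Bad Bad' hB hB' N N' f g]
  have hg0 : 0 ≤ ‖g‖ := norm_nonneg _
  have hf0 : 0 ≤ ‖f‖ := norm_nonneg _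
  -- the three factors applied to the vectors in play
  have hNBf : ‖N (Bad f)‖ ≤ ν * (b * ‖f‖) := (hN _).trans (mul_le_mul_of_nonneg_left (hBad f) hν)
  have hN'd : ‖N' ((Bad - Bad') f)‖ ≤ ν' * (δ₁ * ‖f‖) := (hN' _).trans (mul_le_mul_of_nonneg_left h1f hν')
  have t1 : ‖⟪(Bad - Bad') g, N (Bad f)⟫_ℂ‖ ≤ (δ₁ * ‖g‖) * (ν * (b * ‖f‖)) :=
    (norm_inner_le_norm _ _).trans (mul_le_mul h1g hNBf (norm_nonneg _) (mul_nonneg hδ₁ hg0))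
  have t2 : ‖⟪Bad' g, (N - N') (Bad f)⟫_ℂ‖ ≤ (b' * ‖g‖) * (δ₂ * ‖f‖) :=
    (norm_inner_le_norm _ _).trans (mul_le_mul (hBad' g) h2 (norm_nonneg _) (mul_nonneg hb' hg0))
  have t3 : ‖⟪Bad' g, N' ((Bad - Bad') f)⟫_ℂ‖ ≤ (b' * ‖g‖) * (ν' * (δ₁ * ‖f‖)) :=
    (norm_inner_le_norm _ _).trans (mul_le_mul (hBad' g) hN'd (norm_nonneg _) (mul_nonneg hb' hg0))
  calc ‖⟪(Bad - Bad') g, N (Bad f)⟫_ℂ + ⟪Bad' g, (N - N') (Bad f)⟫_ℂ + ⟪Bad' g, N' ((Bad - Bad') f)⟫_ℂ‖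
      ≤ ‖⟪(Bad - Bad') g, N (Bad f)⟫_ℂ‖ + ‖⟪Bad' g, (N - N') (Bad f)⟫_ℂ‖ + ‖⟪Bad' g, N' ((Bad - Bad') f)⟫_ℂ‖ := norm_add₃_le
    _ ≤ (δ₁ * ‖g‖) * (ν * (b * ‖f‖)) + (b' * ‖g‖) * (δ₂ * ‖f‖) + (b' * ‖g‖) * (ν' * (δ₁ * ‖f‖)) := add_le_add (add_le_add t1 t2) t3
    _ = (δ₁ * ν * b + b' * δ₂ + b' * ν' * δ₁) * ‖g‖ * ‖f‖ := by ring

/-! ## §3 The squares ∕ relative-currency step -/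

/-- **TWO QUADRATIC FORMS OF ONE CONTRACTION AT NEARBY VECTORS**: `‖Tx‖ ≤ ‖x‖` ⟹ `|Re⟪f,Tf⟫ − Re⟪f′,Tf′⟫| ≤ ‖f − f′‖·(‖f‖ + ‖f′‖)`
(`⟪f,Tf⟫ − ⟪f′,Tf′⟫ = ⟪f − f′, Tf⟫ + ⟪f′, T(f − f′)⟫`). [folklore] -/
theorem re_inner_sub_re_inner_le (T : E →ₗ[ℂ] E) (hT : ∀ x, ‖T x‖ ≤ ‖x‖) (f f' : E) :
    |(⟪f, T f⟫_ℂ).re - (⟪f', T f'⟫_ℂ).re| ≤ ‖f - f'‖ * (‖f‖ + ‖f'‖) := by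
  have hid : ⟪f, T f⟫_ℂ - ⟪f', T f'⟫_ℂ = ⟪f - f', T f⟫_ℂ + ⟪f', T (f - f')⟫_ℂ := by
    rw [inner_sub_left, map_sub, inner_sub_right]; ring
  rw [← Complex.sub_re, hid]
  calc |(⟪f - f', T f⟫_ℂ + ⟪f', T (f - f')⟫_ℂ).re| ≤ ‖⟪f - f', T f⟫_ℂ + ⟪f', T (f - f')⟫_ℂ‖ := Complex.abs_re_le_norm _
    _ ≤ ‖⟪f - f', T f⟫_ℂ‖ + ‖⟪f', T (f - f')⟫_ℂ‖ := norm_add_le _ _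
    _ ≤ ‖f - f'‖ * ‖T f‖ + ‖f'‖ * ‖T (f - f')‖ := add_le_add (norm_inner_le_norm _ _) (norm_inner_le_norm _ _)
    _ ≤ ‖f - f'‖ * ‖f‖ + ‖f'‖ * ‖f - f'‖ :=
        add_le_add (mul_le_mul_of_nonneg_left (hT f) (norm_nonneg _)) (mul_le_mul_of_nonneg_left (hT _) (norm_nonneg _))
    _ = ‖f - f'‖ * (‖f‖ + ‖f'‖) := by ring

/-- ★★ **THE SQUARES STEP WITH A LOCAL PROJECTOR ROW**: if `‖⟪f,(P − P′)f⟫‖ ≤ δ_P‖f‖²` (§2 at `g := f`) and `P′` is a contraction, then for any `f′`: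
`|Re⟪f,Pf⟫ − Re⟪f′,P′f′⟫| ≤ δ_P‖f‖² + ‖f − f′‖(‖f‖ + ‖f′‖)` — at the member `f = D*_UA_j`, `f′ = D*_VA_j`, `P = P_U`, `P′ = P_V`.
[cite: Balaban1985BackgroundPropagators, (3.49) p.399] -/
theorem abs_re_inner_sub_le_of_local (P P' : E →ₗ[ℂ] E) (hP' : ∀ x, ‖P' x‖ ≤ ‖x‖) (f f' : E) {δP : ℝ}
    (hloc : ‖⟪f, P f - P' f⟫_ℂ‖ ≤ δP * ‖f‖ ^ 2) :
    |(⟪f, P f⟫_ℂ).re - (⟪f', P' f'⟫_ℂ).re| ≤ δP * ‖f‖ ^ 2 + ‖f - f'‖ * (‖f‖ + ‖f'‖) := by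
  have h1 : (⟪f, P f⟫_ℂ).re - (⟪f', P' f'⟫_ℂ).re = (⟪f, P f - P' f⟫_ℂ).re + ((⟪f, P' f⟫_ℂ).re - (⟪f', P' f'⟫_ℂ).re) := by
    rw [inner_sub_right, Complex.sub_re]; ring
  rw [h1]
  calc |(⟪f, P f - P' f⟫_ℂ).re + ((⟪f, P' f⟫_ℂ).re - (⟪f', P' f'⟫_ℂ).re)|
      ≤ |(⟪f, P f - P' f⟫_ℂ).re| + |(⟪f, P' f⟫_ℂ).re - (⟪f', P' f'⟫_ℂ).re| := abs_add_le _ _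
    _ ≤ δP * ‖f‖ ^ 2 + ‖f - f'‖ * (‖f‖ + ‖f'‖) :=
        add_le_add ((Complex.abs_re_le_norm _).trans hloc) (re_inner_sub_re_inner_le P' hP' f f')

/-- ★★★ **THE RELATIVE CURRENCY** (★p1 g24's note of 2026-08-29 23:14:03Z): if moreover `‖f − f′‖ ≤ κ·a` (`0 ≤ κ`, `0 ≤ a`; at the member `a = ‖A_j‖`,
`κ = 4√3R″ε₀` from ✓`Prop7LocalDivergenceComparison`) then for every `θ > 0`:
**`|Re⟪f,Pf⟫ − Re⟪f′,P′f′⟫| ≤ (δ_P + θ)·‖f‖² + (1 + θ⁻¹)·κ²·a²`** (`‖f′‖ ≤ ‖f‖ + κa`, `2κa‖f‖ ≤ θ‖f‖² + θ⁻¹κ²a²`).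
[cite: Balaban1985BackgroundPropagators, (3.49) p.399] -/
theorem abs_re_inner_sub_le_relative (P P' : E →ₗ[ℂ] E) (hP' : ∀ x, ‖P' x‖ ≤ ‖x‖) (f f' : E) {δP κ a θ : ℝ} (hκ : 0 ≤ κ) (ha : 0 ≤ a) (hθ : 0 < θ)
    (hloc : ‖⟪f, P f - P' f⟫_ℂ‖ ≤ δP * ‖f‖ ^ 2) (hff' : ‖f - f'‖ ≤ κ * a) :
    |(⟪f, P f⟫_ℂ).re - (⟪f', P' f'⟫_ℂ).re| ≤ (δP + θ) * ‖f‖ ^ 2 + (1 + θ⁻¹) * κ ^ 2 * a ^ 2 := by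
  have h0 := abs_re_inner_sub_le_of_local P P' hP' f f' hloc
  have hf : 0 ≤ ‖f‖ := norm_nonneg _
  have hd : 0 ≤ ‖f - f'‖ := norm_nonneg _
  have hf' : ‖f'‖ ≤ ‖f‖ + κ * a := by
    calc ‖f'‖ = ‖f - (f - f')‖ := by rw [sub_sub_cancel]
      _ ≤ ‖f‖ + ‖f - f'‖ := norm_sub_le _ _
      _ ≤ ‖f‖ + κ * a := by linarith
  have hka : 0 ≤ κ * a := mul_nonneg hκ ha
  -- `‖f − f′‖(‖f‖ + ‖f′‖) ≤ κa(2‖f‖ + κa)`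
  have h1 : ‖f - f'‖ * (‖f‖ + ‖f'‖) ≤ κ * a * (2 * ‖f‖ + κ * a) := by
    calc ‖f - f'‖ * (‖f‖ + ‖f'‖) ≤ (κ * a) * (‖f‖ + ‖f'‖) := mul_le_mul_of_nonneg_right hff' (by positivity)
      _ ≤ (κ * a) * (‖f‖ + (‖f‖ + κ * a)) := mul_le_mul_of_nonneg_left (by linarith) hka
      _ = κ * a * (2 * ‖f‖ + κ * a) := by ring
  -- AM–GM: `2κa‖f‖ ≤ θ‖f‖² + θ⁻¹κ²a²`
  have h2 : 2 * (κ * a) * ‖f‖ ≤ θ * ‖f‖ ^ 2 + θ⁻¹ * (κ * a) ^ 2 := by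
    have hθ' : 0 < θ⁻¹ := inv_pos.mpr hθ
    have key : 0 ≤ θ * (‖f‖ - θ⁻¹ * (κ * a)) ^ 2 := mul_nonneg hθ.le (sq_nonneg _)
    have hθθ : θ * θ⁻¹ = 1 := mul_inv_cancel₀ hθ.ne'
    nlinarith [key, hθθ, sq_nonneg (κ * a)]
  calc |(⟪f, P f⟫_ℂ).re - (⟪f', P' f'⟫_ℂ).re| ≤ δP * ‖f‖ ^ 2 + ‖f - f'‖ * (‖f‖ + ‖f'‖) := h0
    _ ≤ δP * ‖f‖ ^ 2 + κ * a * (2 * ‖f‖ + κ * a) := by linarith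
    _ = δP * ‖f‖ ^ 2 + (2 * (κ * a) * ‖f‖ + (κ * a) ^ 2) := by ring
    _ ≤ δP * ‖f‖ ^ 2 + (θ * ‖f‖ ^ 2 + θ⁻¹ * (κ * a) ^ 2 + (κ * a) ^ 2) := by linarith
    _ = (δP + θ) * ‖f‖ ^ 2 + (1 + θ⁻¹) * κ ^ 2 * a ^ 2 := by ring

/-- **`Re⟪f, Pf⟫ = ‖Pf‖²` FOR AN ORTHOGONAL PROJECTION** (`⟪f − Pf, Pf⟫ = 0`; the `Complex.re` edition of lit ✓`B9Eq387CubeLocalisedProjection.re_inner_starProjection_self`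
(`RCLike.re`, any `𝕜`) — not imported, one `RCLike.re_to_complex` away), so §3 reads on `‖P_U(D*_UA_j)‖² − ‖P_V(D*_VA_j)‖²` — the `P`-term of the curved
`flat_coercive_R_T3` in Organisation I (`‖Rf‖² = ‖f‖² − ‖Pf‖²`). [cite: Balaban1985BackgroundPropagators, (3.21) p.394] -/
theorem complex_re_inner_starProjection_self (K : Submodule ℂ E) [K.HasOrthogonalProjection] (f : E) :
    (⟪f, K.starProjection f⟫_ℂ).re = ‖K.starProjection f‖ ^ 2 := by
  have h0 : ⟪f - K.starProjection f, K.starProjection f⟫_ℂ = 0 := K.starProjection_inner_eq_zero f _ (K.starProjection_apply_mem f)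
  have h1 : ⟪f, K.starProjection f⟫_ℂ = ⟪K.starProjection f, K.starProjection f⟫_ℂ := by
    rw [← sub_eq_zero, ← inner_sub_left, h0]
  rw [h1, complex_re_inner_self]

end Summit.QuantumFields.YangMills.Theorems.Prop7ProjectorPerturbationLocal

end
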